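import Literature.NumberTheory.LFunctions.JensenShiftCertificate
import HarnessLib

/-!
# Box lemmas for hyperbolicity: every polynomial with coefficients in a rational box is
# hyperbolic (decidable certificate), the bridge from "rescaled coefficients stay in the box for
# `n ≥ M`" to a hyperbolic tail, and GORZ's `ε₄`-box as a kernel theorem

Griffin–Ono–Rolen–Zagier (PNAS 116 (2019), §5.2) prove Theorem 2 (`J^{d,n}_γ` hyperbolic for all
`n`, `d ≤ 8`) through the renormalised polynomials
`Ĵ^{d,n}_γ(X) = δ(n)^{-d} γ(n)⁻¹ J^{d,n}_γ((δ(n)X - 1)/e^{A(n)}) = Σ_k β^{d,n}_k X^k → H_d(X)` and a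
BOX LEMMA: "we … chose vectors `ε_d` of positive numbers and signs `s_d, …, s_0 ∈ {±1}` for which
`Ĵ^{d,n}_γ(X)` is hyperbolic if `0 ≤ s_k(β^{d,n}_k - h_k) < ε_d(k)` for all `k`"; for `d = 4`,
`ε₄ = (0.041, 1.384, 0.813, 7.313, 0.804)` (listed for `k = 4, 3, 2, 1, 0`; `H₄ = X⁴ - 12X² + 12`),
i.e. the coefficient box `β₄ ∈ (0.959, 1]`, `β₃ ∈ [0, 1.384)`, `β₂ ∈ [-12, -11.187)`,
`β₁ ∈ (-7.313, 0]`, `β₀ ∈ (11.196, 12]`.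

This file makes the box lemma a DECIDABLE CERTIFICATE with a soundness theorem, in the same style as
`JensenShiftCertificate.lean` (whose `JensenCoeffBox` — two lists of rationals — is reused as the
coefficient box):

* `JensenCoeffBox.EnclosesCoeffs B d p` — `deg p ≤ d < size` and `lo k ≤ [X^k] p ≤ hi k` (`k ≤ d`);
* `JensenCoeffBox.coeffEvalLower/Upper`, `coeffSignAt` — termwise interval evaluation of
  `Σ_{k ≤ d} a_k x^k` over the box at a rational point (exact for fixed `x`: the value is linear in
  the coefficient vector) [Moore 1979, Thm. 3.1];
* `JensenCoeffBox.CoeffCertifies B d u` — `d + 1` strictly increasing rational points with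
  alternating certified signs (decidable); SOUNDNESS `splits_of_coeffCertifies`: every real
  polynomial the box encloses splits over `ℝ` (`d` strict sign changes, IVT, degree `≤ d`
  [Szegő §3.3 (5)–(6)]; tree lemmas `exists_roots_of_alternating`, `splits_of_roots`);
* the BRIDGE `jensenHyperbolicFrom_of_rescaledCoeffsInBox`: if the coefficients of the tree's
  `jensenPolyRescaled α E δ d n` (GORZ's `Ĵ^{d,n}` with a general `E(n)`) lie in a certified box for
  every `n ≥ M` — the named proposition `RescaledCoeffsInBox α E δ d M B`, which is what an effective
  asymptotic expansion of `log(α(n+j)/α(n))` delivers (PLAN (S1)+(S3)) — then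
  `JensenHyperbolicFrom α d M` (`splits_jensenPoly_of_splits_rescaled`: hyperbolicity is invariant
  under the affine substitution);
* the full fixed-degree shape `jensenPoly_splits_allShifts_of_inBox_of_certificates`:
  (coefficients in box for `n ≥ M`) + (box certificate) + (coefficient enclosures of `α`) +
  (range certificate below `M`) ⇒ `J^{d,n}_α` hyperbolic for every `n`;
* GORZ's `ε₄`-BOX AS A KERNEL THEOREM: the closed box above with the sign points
  `-6 < -5/2 < -7/8 < 5/4 < 15/4` is accepted by `decide +kernel` (interval values
  `[523.1, 949.2]`, `[-47.97, -0.5737]`, `[1.643, 10.43]`, `[-14.36, -0.3351]`, `[4.668, 125.5]`), so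
  every real polynomial of degree `≤ 4` with coefficients in it splits (`splits_of_mem_gorzBoxFour`),
  and the printed box lemma at `d = 4` holds for `Ĵ^{4,n}_γ` with ANY normalisation `E, δ ≠ 0`
  (`gorz2019_boxLemma_four`). The same five points were found independently by the track's referee
  (JREF-BOX4, exact rationals).

What is NOT here: the effective asymptotics that put `β^{d,n}` in the box (GORZ's unprinted
"effective form of (16)"; typed as the hypothesis `RescaledCoeffsInBox`), and any statement about
zeros of `ζ`.

## References
* [GORZPNAS2019] Griffin–Ono–Rolen–Zagier, PNAS 116 (2019) 11103–11110, Thm. 3 eq. (5), §5.2.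
* [Moore1979] R. E. Moore, *Methods and Applications of Interval Analysis*, SIAM 1979, Ch. 3, Thm. 3.1.
* [Szego1939] G. Szegő, *Orthogonal Polynomials*, §3.3 (5)–(6).
-/

open Polynomial Finset

namespace Literature.NumberTheory.LFunctions

namespace JensenCoeffBox

/-! ## Coefficient boxes for a polynomial of degree `≤ d` -/

/-- The box encloses the coefficient vector of `p`: `deg p ≤ d`, `d < size`, and
`lo k ≤ [X^k] p ≤ hi k` for `k ≤ d`. [cite: Moore1979, Ch. 3, Thm. 3.1] -/
def EnclosesCoeffs (B : JensenCoeffBox) (d : ℕ) (p : ℝ[X]) : Prop :=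
  p.natDegree ≤ d ∧ d < B.size ∧
    ∀ k : ℕ, k ≤ d → ((B.lo.getD k 0 : ℚ) : ℝ) ≤ p.coeff k ∧ p.coeff k ≤ ((B.hi.getD k 0 : ℚ) : ℝ)

/-- Lower bound of the term `a_k x^k` over the box. [folklore] -/
def coeffTermLower (B : JensenCoeffBox) (k : ℕ) (x : ℚ) : ℚ :=
  if 0 ≤ x ^ k then x ^ k * B.lo.getD k 0 else x ^ k * B.hi.getD k 0

/-- Upper bound of the term `a_k x^k` over the box. [folklore] -/
def coeffTermUpper (B : JensenCoeffBox) (k : ℕ) (x : ℚ) : ℚ :=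
  if 0 ≤ x ^ k then x ^ k * B.hi.getD k 0 else x ^ k * B.lo.getD k 0

/-- Lower bound of `p(x) = Σ_{k ≤ d} a_k x^k` over the box. [folklore] -/
def coeffEvalLower (B : JensenCoeffBox) (d : ℕ) (x : ℚ) : ℚ :=
  ∑ k ∈ range (d + 1), B.coeffTermLower k x

/-- Upper bound of `p(x)` over the box. [folklore] -/
def coeffEvalUpper (B : JensenCoeffBox) (d : ℕ) (x : ℚ) : ℚ :=
  ∑ k ∈ range (d + 1), B.coeffTermUpper k x

/-- Certified sign of `p(x)` over the box (`1`, `-1`, or `0` = undecided). [folklore] -/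
def coeffSignAt (B : JensenCoeffBox) (d : ℕ) (x : ℚ) : ℤ :=
  if 0 < B.coeffEvalLower d x then 1 else if B.coeffEvalUpper d x < 0 then -1 else 0

/-- **Box-lemma certificate**: `d + 1` strictly increasing rational points with alternating
certified signs over the whole coefficient box. Decidable. [cite: Szego1939, §3.3 (5)–(6)] -/
def CoeffCertifies (B : JensenCoeffBox) (d : ℕ) (u : Fin (d + 1) → ℚ) : Prop :=
  d < B.size ∧ (∀ i : Fin d, u i.castSucc < u i.succ) ∧
    ∀ i : Fin d, B.coeffSignAt d (u i.castSucc) * B.coeffSignAt d (u i.succ) = -1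

/-- `CoeffCertifies` is decidable (rational arithmetic). [folklore] -/
instance (B : JensenCoeffBox) (d : ℕ) (u : Fin (d + 1) → ℚ) : Decidable (B.CoeffCertifies d u) := by
  unfold CoeffCertifies; infer_instance

/-! ## Soundness of the box-lemma certificate -/

variable {B : JensenCoeffBox} {d : ℕ} {p : ℝ[X]}

/-- `p(x) = Σ_{k ≤ d} [X^k]p · x^k` for `deg p ≤ d`. [folklore] -/
private theorem eval_eq_sum_range_of_le (hp : p.natDegree ≤ d) (x : ℝ) :
    p.eval x = ∑ k ∈ range (d + 1), p.coeff k * x ^ k := by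
  rw [eval_eq_sum_range' (Nat.lt_succ_of_le hp)]

/-- Termwise bounds over the box. [folklore] -/
private theorem coeffTerm_bounds (h : B.EnclosesCoeffs d p) {k : ℕ} (hk : k ≤ d) (x : ℚ) :
    ((B.coeffTermLower k x : ℚ) : ℝ) ≤ p.coeff k * (x : ℝ) ^ k ∧
      p.coeff k * (x : ℝ) ^ k ≤ ((B.coeffTermUpper k x : ℚ) : ℝ) := by
  obtain ⟨hlo, hhi⟩ := h.2.2 k hk
  unfold coeffTermLower coeffTermUpper
  split_ifs with hc
  · have hc' : (0 : ℝ) ≤ (x : ℝ) ^ k := by exact_mod_cast hc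
    push_cast
    constructor <;> nlinarith [mul_le_mul_of_nonneg_left hlo hc', mul_le_mul_of_nonneg_left hhi hc']
  · have hc' : (x : ℝ) ^ k ≤ 0 := by exact_mod_cast (not_le.1 hc).le
    push_cast
    constructor <;>
      nlinarith [mul_le_mul_of_nonpos_left hlo hc', mul_le_mul_of_nonpos_left hhi hc']

/-- `coeffEvalLower ≤ p(x) ≤ coeffEvalUpper` over the box (interval evaluation of a form linear
in the coefficients encloses its range). [cite: Moore1979, Ch. 3, Thm. 3.1] -/
theorem coeffEval_bounds (h : B.EnclosesCoeffs d p) (x : ℚ) :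
    ((B.coeffEvalLower d x : ℚ) : ℝ) ≤ p.eval (x : ℝ) ∧
      p.eval (x : ℝ) ≤ ((B.coeffEvalUpper d x : ℚ) : ℝ) := by
  rw [eval_eq_sum_range_of_le h.1, coeffEvalLower, coeffEvalUpper, Rat.cast_sum, Rat.cast_sum]
  constructor
  · exact Finset.sum_le_sum fun k hk =>
      (coeffTerm_bounds h (Nat.le_of_lt_succ (Finset.mem_range.1 hk)) x).1
  · exact Finset.sum_le_sum fun k hk =>
      (coeffTerm_bounds h (Nat.le_of_lt_succ (Finset.mem_range.1 hk)) x).2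

/-- Opposite certified signs at two points give a sign change of `p`. [folklore] -/
private theorem eval_mul_eval_neg_of_coeffSignAt (h : B.EnclosesCoeffs d p) {x y : ℚ}
    (hs : B.coeffSignAt d x * B.coeffSignAt d y = -1) :
    p.eval (x : ℝ) * p.eval (y : ℝ) < 0 := by
  have pos : ∀ {z : ℚ}, B.coeffSignAt d z = 1 → 0 < p.eval (z : ℝ) := by
    intro z hz
    have h1 : 0 < B.coeffEvalLower d z := by
      by_contra hc
      unfold coeffSignAt at hz
      rw [if_neg hc] at hz
      by_cases h2 : B.coeffEvalUpper d z < 0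
      · rw [if_pos h2] at hz; omega
      · rw [if_neg h2] at hz; omega
    exact lt_of_lt_of_le (by exact_mod_cast h1) (coeffEval_bounds h z).1
  have neg : ∀ {z : ℚ}, B.coeffSignAt d z = -1 → p.eval (z : ℝ) < 0 := by
    intro z hz
    have h2 : B.coeffEvalUpper d z < 0 := by
      by_contra hc
      unfold coeffSignAt at hz
      by_cases h1 : 0 < B.coeffEvalLower d z
      · rw [if_pos h1] at hz; omega
      · rw [if_neg h1, if_neg hc] at hz; omega
    exact lt_of_le_of_lt (coeffEval_bounds h z).2 (by exact_mod_cast h2)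
  have hx : B.coeffSignAt d x = 1 ∨ B.coeffSignAt d x = -1 ∨ B.coeffSignAt d x = 0 := by
    unfold coeffSignAt; split_ifs <;> simp
  have hy : B.coeffSignAt d y = 1 ∨ B.coeffSignAt d y = -1 ∨ B.coeffSignAt d y = 0 := by
    unfold coeffSignAt; split_ifs <;> simp
  rcases hx with hx | hx | hx <;> rcases hy with hy | hy | hy <;> rw [hx, hy] at hs <;> norm_num at hs
  · exact mul_neg_of_pos_of_neg (pos hx) (neg hy)
  · exact mul_neg_of_neg_of_pos (neg hx) (pos hy)

/-- **Soundness of the box lemma certificate**: if `(d, u)` is certified for the box `B`, then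
EVERY real polynomial of degree `≤ d` whose coefficients lie in `B` splits over `ℝ` (it has `d`
strict sign changes, hence `d` distinct real roots). [cite: Szego1939, §3.3 (5)–(6)] -/
theorem splits_of_coeffCertifies {u : Fin (d + 1) → ℚ} (hc : B.CoeffCertifies d u)
    (h : B.EnclosesCoeffs d p) : p.Splits := by
  obtain ⟨-, hmono, halt⟩ := hc
  rcases Nat.eq_zero_or_pos d with rfl | hd
  · rw [eq_C_of_natDegree_le_zero h.1]
    exact Splits.C _
  · have hu : StrictMono (fun i : Fin (d + 1) => ((u i : ℚ) : ℝ)) :=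
      Fin.strictMono_iff_lt_succ.2 fun i => by exact_mod_cast hmono i
    have halt' : ∀ i : Fin d,
        p.eval (((u i.castSucc : ℚ)) : ℝ) * p.eval (((u i.succ : ℚ)) : ℝ) < 0 :=
      fun i => eval_mul_eval_neg_of_coeffSignAt h (halt i)
    obtain ⟨t, ht, -, hroot⟩ :=
      exists_roots_of_alternating p (fun i : Fin (d + 1) => ((u i : ℚ) : ℝ)) hu halt'
    have hp0 : p ≠ 0 := by
      intro h0
      have := halt' ⟨0, hd⟩
      rw [h0] at this
      simp at this
    exact (splits_of_roots hp0 h.1 t ht.injective hroot).1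

end JensenCoeffBox

/-! ## From "rescaled coefficients in a certified box for `n ≥ M`" to a hyperbolic tail -/

/-- **Named shape of the effective asymptotic input** (PLAN (S1)+(S3); GORZ §5.2: "the required
inequalities hold for `n ≥ M_{ε_d}`"): for every `n ≥ M` the normalisation data are admissible
(`α(n), E(n), δ(n) ≠ 0`) and the coefficient vector of the renormalised Jensen polynomial
`jensenPolyRescaled α E δ d n = δ(n)^{-d} α(n)⁻¹ J^{d,n}_α((δ(n)X - 1)/E(n))` lies in the box `B`.
[cite: GORZPNAS2019, §5.2] -/
def RescaledCoeffsInBox (α E δ : ℕ → ℝ) (d M : ℕ) (B : JensenCoeffBox) : Prop :=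
  ∀ n : ℕ, M ≤ n → α n ≠ 0 ∧ E n ≠ 0 ∧ δ n ≠ 0 ∧ B.EnclosesCoeffs d (jensenPolyRescaled α E δ d n)

/-- **Bridge**: coefficients in a certified box from `M` on ⇒ `J^{d,n}_α` hyperbolic for every
`n ≥ M` (the renormalised polynomial splits by the box lemma; hyperbolicity is invariant under the
affine substitution, `splits_jensenPoly_of_splits_rescaled`). [cite: GORZPNAS2019, §5.2] -/
theorem jensenHyperbolicFrom_of_rescaledCoeffsInBox {α E δ : ℕ → ℝ} {d M : ℕ} {B : JensenCoeffBox}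
    (hIn : RescaledCoeffsInBox α E δ d M B) {u : Fin (d + 1) → ℚ} (hc : B.CoeffCertifies d u) :
    JensenHyperbolicFrom α d M := by
  intro n hn
  obtain ⟨hα, hE, hδ, hbox⟩ := hIn n hn
  exact splits_jensenPoly_of_splits_rescaled hα hE hδ (JensenCoeffBox.splits_of_coeffCertifies hc hbox)

/-- **Fixed degree, all shifts — the full certificate shape** (PLAN: `jensen_allShifts_deg_d`):
(i) the effective-asymptotic input "rescaled coefficients in the box `Bbox` for `n ≥ M`" (named
hypothesis), (ii) the box-lemma certificate for `Bbox` (decidable), (iii) coefficient enclosures of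
`α` (certified numerics), (iv) the range certificate for the shifts `n < M` (decidable) ⇒
`J^{d,n}_α` is hyperbolic for every `n`. [cite: GORZPNAS2019, Thm. 2 and §5.2] -/
theorem jensenPoly_splits_allShifts_of_inBox_of_certificates {α E δ : ℕ → ℝ} {d M : ℕ}
    {Bbox : JensenCoeffBox} (hIn : RescaledCoeffsInBox α E δ d M Bbox) {ubox : Fin (d + 1) → ℚ}
    (hbox : Bbox.CoeffCertifies d ubox) {B : JensenCoeffBox} (hB : B.Encloses α)
    {U : Fin M → Fin (d + 1) → ℚ} (hfin : B.CertifiesRange d M U) (n : ℕ) :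
    (jensenPoly α d n).Splits :=
  jensenPoly_splits_allShifts_of_from_of_certifiesRange
    (jensenHyperbolicFrom_of_rescaledCoeffsInBox hIn hbox) hB hfin n

/-! ## GORZ's `ε₄`-box, kernel-certified -/

/-- **GORZ's `ε₄`-box** (§5.2, Example `d = 4`: `ε₄ = (0.041, 1.384, 0.813, 7.313, 0.804)` for
`k = 4, …, 0`, signs read off the printed brackets; `H₄ = X⁴ - 12X² + 12`), CLOSED:
`β₀ ∈ [11.196, 12]`, `β₁ ∈ [-7.313, 0]`, `β₂ ∈ [-12, -11.187]`, `β₃ ∈ [0, 1.384]`, `β₄ ∈ [0.959, 1]`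
(lists indexed by the power `k`). [cite: GORZPNAS2019, §5.2] -/
def gorzBoxFour : JensenCoeffBox :=
  ⟨[11.196, -7.313, -12, 0, 0.959], [12, 0, -11.187, 1.384, 1]⟩

/-- **The `ε₄`-box certificate is accepted** with the sign points `-6 < -5/2 < -7/8 < 5/4 < 15/4`
(kernel evaluation, standard axioms; the same points as the track referee's exact-rational check
JREF-BOX4). [cite: GORZPNAS2019, §5.2] -/
theorem gorzBoxFour_coeffCertifies :
    gorzBoxFour.CoeffCertifies 4 ![-6, -5 / 2, -7 / 8, 5 / 4, 15 / 4] := by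
  decide +kernel

/-- **GORZ's box lemma at `d = 4`, proved**: every real polynomial of degree `≤ 4` with
`[X⁰] ∈ [11.196, 12]`, `[X¹] ∈ [-7.313, 0]`, `[X²] ∈ [-12, -11.187]`, `[X³] ∈ [0, 1.384]`,
`[X⁴] ∈ [0.959, 1]` is hyperbolic. [cite: GORZPNAS2019, §5.2] -/
theorem splits_of_mem_gorzBoxFour {p : ℝ[X]} (h : gorzBoxFour.EnclosesCoeffs 4 p) : p.Splits :=
  JensenCoeffBox.splits_of_coeffCertifies gorzBoxFour_coeffCertifies h

/-- Unfolded form of membership in the `ε₄`-box. [cite: GORZPNAS2019, §5.2] -/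
theorem gorzBoxFour_enclosesCoeffs_iff (p : ℝ[X]) :
    gorzBoxFour.EnclosesCoeffs 4 p ↔ p.natDegree ≤ 4 ∧
      (11.196 ≤ p.coeff 0 ∧ p.coeff 0 ≤ 12) ∧ (-7.313 ≤ p.coeff 1 ∧ p.coeff 1 ≤ 0) ∧
      (-12 ≤ p.coeff 2 ∧ p.coeff 2 ≤ -11.187) ∧ (0 ≤ p.coeff 3 ∧ p.coeff 3 ≤ 1.384) ∧
      (0.959 ≤ p.coeff 4 ∧ p.coeff 4 ≤ 1) := by
  unfold JensenCoeffBox.EnclosesCoeffs gorzBoxFour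
  have hsize : JensenCoeffBox.size ⟨[11.196, -7.313, -12, 0, 0.959], [12, 0, -11.187, 1.384, 1]⟩
      = 5 := rfl
  simp only [hsize, show (4 : ℕ) < 5 from by norm_num, true_and]
  constructor
  · rintro ⟨hdeg, h⟩
    have h0 := h 0 (by norm_num); have h1 := h 1 (by norm_num); have h2 := h 2 (by norm_num)
    have h3 := h 3 (by norm_num); have h4 := h 4 (by norm_num)
    simp only [List.getD_cons_zero, List.getD_cons_succ] at h0 h1 h2 h3 h4
    push_cast at h0 h1 h2 h3 h4
    exact ⟨hdeg, h0, h1, h2, h3, h4⟩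
  · rintro ⟨hdeg, h0, h1, h2, h3, h4⟩
    refine ⟨hdeg, fun k hk => ?_⟩
    interval_cases k <;>
      simp only [List.getD_cons_zero, List.getD_cons_succ] <;> push_cast <;> assumption

/-- **The printed box lemma for `Ĵ^{4,n}_γ`** (GORZ §5.2: "`Ĵ^{d,n}_γ(X)` is hyperbolic if
`0 ≤ s_k(β^{d,n}_k - h_k) < ε_d(k)` for all `k`", `d = 4`), for ANY admissible normalisation
`E(n), δ(n) ≠ 0` (GORZ's (18) is one choice) and any positive sequence `α` (for `ξ`:
`α = xiTaylorCoeff`): if the coefficients `β^{4,n}_k` of `jensenPolyRescaled α E δ 4 n` satisfy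
the printed inequalities, then `J^{4,n}_α` is hyperbolic. [cite: GORZPNAS2019, §5.2] -/
theorem gorz2019_boxLemma_four {α E δ : ℕ → ℝ} {n : ℕ} (hα : α n ≠ 0) (hE : E n ≠ 0)
    (hδ : δ n ≠ 0)
    (h0 : 0 ≤ -((jensenPolyRescaled α E δ 4 n).coeff 0 - 12) ∧
      -((jensenPolyRescaled α E δ 4 n).coeff 0 - 12) < 0.804)
    (h1 : 0 ≤ -((jensenPolyRescaled α E δ 4 n).coeff 1 - 0) ∧
      -((jensenPolyRescaled α E δ 4 n).coeff 1 - 0) < 7.313)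
    (h2 : 0 ≤ (jensenPolyRescaled α E δ 4 n).coeff 2 - (-12) ∧
      (jensenPolyRescaled α E δ 4 n).coeff 2 - (-12) < 0.813)
    (h3 : 0 ≤ (jensenPolyRescaled α E δ 4 n).coeff 3 - 0 ∧
      (jensenPolyRescaled α E δ 4 n).coeff 3 - 0 < 1.384)
    (h4 : 0 ≤ -((jensenPolyRescaled α E δ 4 n).coeff 4 - 1) ∧
      -((jensenPolyRescaled α E δ 4 n).coeff 4 - 1) < 0.041) :
    (jensenPoly α 4 n).Splits := by
  refine splits_jensenPoly_of_splits_rescaled hα hE hδ (splits_of_mem_gorzBoxFour ?_)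
  rw [gorzBoxFour_enclosesCoeffs_iff]
  refine ⟨natDegree_jensenPolyRescaled_le α E δ 4 n, ⟨?_, ?_⟩, ⟨?_, ?_⟩, ⟨?_, ?_⟩, ⟨?_, ?_⟩, ⟨?_, ?_⟩⟩
  all_goals linarith [h0.1, h0.2, h1.1, h1.2, h2.1, h2.2, h3.1, h3.2, h4.1, h4.2]

end Literature.NumberTheory.LFunctions
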